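/-
Copyright (c) 2026 the pub-hodgecm-mathlib formalisation cell (harness21).  Prover seat hodgecm-mathlib-F0P3a-p01 (g36), FLOOR 0, SUPPORTS-ONLY on h413; dealer LH4-plan (g13)
WORD #74 (1): owner of (T-box | lev) (b)+(c) — the two-token labelled κ-box-sum `LevLabelledBoxSumWide` (★ p860066 ∕ ED. 2) and its proof.  FILE 1 «LEV PLANES».  2026-09-04.
-/
import Summits.HodgeConjecture.HodgeConjecture.Theorems.F0P3cDyRamKappaCountBoxSumPlanes   -- ★ p14 FILE 2: `kappa_plane_sum`, `sum_glueDouble`, brings BLOCKS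
import HarnessLib

/-!
# Crux `H413`, LH4 «(D-RAM) FOUR-FRAME» road, STAGE 1b — brick (T-box | lev) FILE 1∕3 «LEV PLANES»: one plane of the TWO-TOKEN labelled κ-table in closed form

Cell `hodgecm-mathlib` (D-0151), crux item H413 = `stmt-HodgeConjecture-24833`, route of record `HCCMUnconditional`.  THEOREMS ONLY (pure finite-sum bookkeeping over a
commutative ring; no lattices, no `def`, no instance, no notation, no `sorry`, default heartbeats); lane `--supports stmt-HodgeConjecture-24833 --as helper` (count-neutral).
Twin of ★ `F0P3cDyRamKappaCountBoxSumPlanes.kappa_plane_sum` (LH4-p14 (g3)) for the tables of ★ p860066 `LevLabelledBoxSum(Wide) ℓ₁ ℓ₂` (memo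
`F0/P3a/F0P3a-p01/g36/tbox/TBOX-LEV-SPEC.v1.F0P3ap01g36.md` 7f362386; NET tables certified cell by cell by `netcheck.py`).

THE MATHEMATICS.  Fix a slot and one apex plane (apex depth `n`, glue leg `n'`, third leg `n''`).  Under the two label tokens `D₁` (level `ℓ₁`) and `D₂` (level `ℓ₂`) the
plane's κ-table is (i) the unit's ON-BRANCH + TUBE table at the SHIFTED parameters `ñ = n − ℓ₁` (apex read `s + ℓ₁ ≤ n`, `2ρ + s + ℓ₁ ≤ n`) and
`N = min(min(n', n''), n_r − ℓ₁, 2n_r − ℓ₂)` (glue reads `2ρ + ℓ₁ ≤ n_r`, `2ρ + ℓ₂ ≤ 2n_r` on the READ LEG `n_r` = `n₂, n₁, n₂` for the planes of apex `0, 1, 2`, as in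
★ p860066's `hG1∕hG2∕hG3`) — so ★ `kappa_plane_sum` evaluates it verbatim — plus (ii) the `D₁`-LOCUS COLUMN
`s = n − n'` (`n' = n''`): rows `r = 2ρ` with `n' − ℓ₁ < 2ρ`, `ℓ₁ + ρ ≤ n'`, `X = ℓ₁ + 2ρ − n' ≤ n' − d + 1`, `2ρ + ℓ₂ ≤ 2n'`, cell `ε·[brk s ⌈X∕2⌉]·x^{2ρ + s∕2 − ⌈X∕2⌉}`;
re-indexed by `c = ⌈X∕2⌉ = ρ − ⌊(n' − ℓ₁)∕2⌋` these are the CONSECUTIVE powers `x^{2⌊(n'−ℓ₁)∕2⌋ + s∕2 + c}`, `1 ≤ c ≤ C`,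
`C = min(n' − ℓ₁ − M, ⌊(2n' − ℓ₂)∕2⌋ − M, ⌊(2n' − d + 1 − ℓ₁)∕2⌋ − M)`, `M = ⌊(n' − ℓ₁)∕2⌋` — the unit's glue window (`ℓ₁ = ℓ₂ = 0`: `C = (n'−d)∕2 + d%2`) shifted and clipped.
* §1 `sum_levWindow_reindex` — the locus rows re-indexed by `c`.
* §2 `sum_locusDouble_lev` — the locus column's double sum collapsed to the window `ε·Σ_{c ∈ Icc 1 C} [brk s c]·x^{2⌊(n'−ℓ₁)∕2⌋ + s∕2 + c}`.
* §3 **`kappa_plane_sum_lev`** — HEAD: the whole plane = ★ `kappa_plane_sum`'s tube part at `(ñ, N)` + §2's window (read leg `n_r` free: `n'` or `n''`).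
* §4 `kappa_diag_sum_lev` — the core-hanging diagonal with the same shift (`X = ℓ₁ + 2ρ − m`), twin of ★ `kappa_diag_sum`, parity-free.

HONEST LABEL: arithmetic helper toward `levLabelledBoxSumWide_holds`; pays no tier-0 row; the four (L-lev) law stubs and their `hTrunk` binders stay OPEN; HC_CM is proved only
modulo the 7 printed citations (2 remaining named inputs: hLiu418 = `stmt-HodgeConjecture-24832`, h413 = `stmt-HodgeConjecture-24833`) until rung 0 closes.

## References
* [Kottwitz1986BaseChangeUnits] R. E. Kottwitz, *Base change for unit elements of Hecke algebras*, Compositio Math. 60 (1986), §1 pp. 240–241 (signed lattice counts stratum by stratum).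
* [Rogawski1990] J. D. Rogawski, *Automorphic Representations of Unitary Groups in Three Variables*, Ann. of Math. Stud. 123 (1990), §4.9 Prop. 4.9.1 (a) p. 55.
-/

set_option autoImplicit false

namespace Summit.HodgeConjecture.HodgeConjecture.Cruxes.H413.F0P3cDyRamLevBoxSumPlanes

open Finset
open Summit.HodgeConjecture.HodgeConjecture.Cruxes.H413.F0P3cDyRamKappaCountBoxSumPlanes (kappa_plane_sum)

section Window

variable {R : Type*} [CommRing R]

/-- **THE LOCUS ROWS RE-INDEXED**: the even `r` with `m < r + ℓ₁`, `ℓ₁ + r∕2 ≤ m`, `ℓ₁ + r − m ≤ m − d + 1`, `r + ℓ₂ ≤ 2m` are `r = 2(⌊(m−ℓ₁)∕2⌋ + c)`,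
`1 ≤ c ≤ C`, `C = min(m − ℓ₁ − M, ⌊(2m−ℓ₂)∕2⌋ − M, ⌊(2m−d+1−ℓ₁)∕2⌋ − M)`, `M = ⌊(m−ℓ₁)∕2⌋` (`d, ℓ₁ ≤ m`), with `⌈(ℓ₁ + r − m)∕2⌉ = (ℓ₁ + r − m + 1)∕2 = c` and `r − c = 2⌊(m−ℓ₁)∕2⌋ + c`
(generalises ★ `sum_glueWindow_reindex`, the case `ℓ₁ = ℓ₂ = 0`). [folklore] -/
theorem sum_levWindow_reindex (F : ℕ → ℕ → R) {m d ℓ₁ ℓ₂ B : ℕ} (hdm : d ≤ m) (hℓ₁ : ℓ₁ ≤ m) (hB : 2 * m ≤ B) :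
    ∑ r ∈ range (B + 1), (if 2 ∣ r ∧ m < r + ℓ₁ ∧ ℓ₁ + r / 2 ≤ m ∧ ℓ₁ + r - m ≤ m - d + 1 ∧ r + ℓ₂ ≤ 2 * m then
        F ((ℓ₁ + r - m + 1) / 2) (r - (ℓ₁ + r - m + 1) / 2) else 0)
      = ∑ c ∈ Icc 1 (min (m - ℓ₁ - (m - ℓ₁) / 2) (min ((2 * m - ℓ₂) / 2 - (m - ℓ₁) / 2) ((2 * m - d + 1 - ℓ₁) / 2 - (m - ℓ₁) / 2))), F c (2 * ((m - ℓ₁) / 2) + c) := by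
  rw [← Finset.sum_filter]
  set C := min (m - ℓ₁ - (m - ℓ₁) / 2) (min ((2 * m - ℓ₂) / 2 - (m - ℓ₁) / 2) ((2 * m - d + 1 - ℓ₁) / 2 - (m - ℓ₁) / 2)) with hC
  have hinj : Set.InjOn (fun c : ℕ => 2 * ((m - ℓ₁) / 2) + 2 * c) ↑(Icc 1 C) := by
    intro u _ v _ huv
    have : 2 * ((m - ℓ₁) / 2) + 2 * u = 2 * ((m - ℓ₁) / 2) + 2 * v := huv
    omega
  have hset : (range (B + 1)).filter (fun r => 2 ∣ r ∧ m < r + ℓ₁ ∧ ℓ₁ + r / 2 ≤ m ∧ ℓ₁ + r - m ≤ m - d + 1 ∧ r + ℓ₂ ≤ 2 * m)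
      = (Icc 1 C).image (fun c => 2 * ((m - ℓ₁) / 2) + 2 * c) := by
    ext r
    simp only [Finset.mem_filter, Finset.mem_range, Finset.mem_image, Finset.mem_Icc, Nat.dvd_iff_mod_eq_zero, hC, le_min_iff]
    constructor
    · rintro ⟨hrB, hr2, h1, h2, h3, h4⟩
      exact ⟨r / 2 - (m - ℓ₁) / 2, ⟨by omega, by omega, by omega, by omega⟩, by omega⟩
    · rintro ⟨c, ⟨hc1, hA, hB', hC'⟩, rfl⟩
      exact ⟨by omega, by omega, by omega, by omega, by omega, by omega⟩
  rw [hset, Finset.sum_image hinj]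
  refine Finset.sum_congr rfl fun c hc => ?_
  simp only [Finset.mem_Icc] at hc
  have e1 : (ℓ₁ + (2 * ((m - ℓ₁) / 2) + 2 * c) - m + 1) / 2 = c := by omega
  have e2 : 2 * ((m - ℓ₁) / 2) + 2 * c - c = 2 * ((m - ℓ₁) / 2) + c := by omega
  rw [e1, e2]

/-- **THE LOCUS COLUMN DOUBLE SUM of one plane**: the `D₁`-locus cells `(r, t) = (r, r + (n − n'))`, `r` even in the shifted∕clipped window, bracket `brk`, collapse to
`ε·Σ_{1 ≤ c ≤ C} [brk (n−n') c]·x^{2⌊(n'−ℓ₁)∕2⌋ + (n−n')∕2 + c}` (and vanish unless `n' = n'' < n`, `n ≡ n'`). [folklore] -/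
theorem sum_locusDouble_lev (x ε : R) (brk : ℕ → ℕ → Prop) [DecidableRel brk] {d n n' n'' ℓ₁ ℓ₂ B : ℕ} (hdn' : d ≤ n') (hℓ₁ : ℓ₁ ≤ n')
    (hB : n + n' ≤ B) :
    ∑ r ∈ range (B + 1), ∑ t ∈ range (B + 1),
        (if 1 ≤ r ∧ r < t ∧ 2 ∣ r ∧ 2 ∣ (t - r) ∧ n' = n'' ∧ n = n' + (t - r) ∧ n' < r + ℓ₁ ∧ ℓ₁ + r / 2 ≤ n' ∧ ℓ₁ + r - n' ≤ n' - d + 1 ∧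
            r + ℓ₂ ≤ 2 * n' ∧ brk (t - r) ((ℓ₁ + r - n' + 1) / 2)
          then ε * x ^ (r + (t - r) / 2 - (ℓ₁ + r - n' + 1) / 2) else 0)
      = if n' = n'' ∧ n' < n ∧ (n - n') % 2 = 0 then
          ε * ∑ c ∈ Icc 1 (min (n' - ℓ₁ - (n' - ℓ₁) / 2) (min ((2 * n' - ℓ₂) / 2 - (n' - ℓ₁) / 2) ((2 * n' - d + 1 - ℓ₁) / 2 - (n' - ℓ₁) / 2))),
            (if brk (n - n') c then x ^ (2 * ((n' - ℓ₁) / 2) + (n - n') / 2 + c) else 0)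
        else 0 := by
  by_cases hc : n' = n'' ∧ n' < n ∧ (n - n') % 2 = 0
  · obtain ⟨hc1, hc2, hc3⟩ := hc
    rw [if_pos ⟨hc1, hc2, hc3⟩]
    -- collapse the inner sum at `t = r + (n − n')`
    have hrow : ∀ r ∈ range (B + 1), ∑ t ∈ range (B + 1),
        (if 1 ≤ r ∧ r < t ∧ 2 ∣ r ∧ 2 ∣ (t - r) ∧ n' = n'' ∧ n = n' + (t - r) ∧ n' < r + ℓ₁ ∧ ℓ₁ + r / 2 ≤ n' ∧ ℓ₁ + r - n' ≤ n' - d + 1 ∧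
            r + ℓ₂ ≤ 2 * n' ∧ brk (t - r) ((ℓ₁ + r - n' + 1) / 2)
          then ε * x ^ (r + (t - r) / 2 - (ℓ₁ + r - n' + 1) / 2) else 0)
        = if 2 ∣ r ∧ n' < r + ℓ₁ ∧ ℓ₁ + r / 2 ≤ n' ∧ ℓ₁ + r - n' ≤ n' - d + 1 ∧ r + ℓ₂ ≤ 2 * n' then
            (if brk (n - n') ((ℓ₁ + r - n' + 1) / 2) then ε * x ^ ((r - (ℓ₁ + r - n' + 1) / 2) + (n - n') / 2) else 0) else 0 := by
      intro r hr
      simp only [Finset.mem_range] at hr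
      rw [Finset.sum_eq_single (r + (n - n'))]
      · simp only [Nat.add_sub_cancel_left]
        by_cases hw : 2 ∣ r ∧ n' < r + ℓ₁ ∧ ℓ₁ + r / 2 ≤ n' ∧ ℓ₁ + r - n' ≤ n' - d + 1 ∧ r + ℓ₂ ≤ 2 * n'
        · rw [if_pos hw]
          by_cases hb : brk (n - n') ((ℓ₁ + r - n' + 1) / 2)
          · have h1r : 1 ≤ r := by obtain ⟨-, h, -, -, -⟩ := hw; omega
            rw [if_pos hb, if_pos ⟨h1r, by omega, hw.1, by omega, hc1, by omega, hw.2.1, hw.2.2.1, hw.2.2.2.1, hw.2.2.2.2, hb⟩]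
            congr 2
            exact Nat.sub_add_comm (by omega)
          · rw [if_neg hb, if_neg (fun h => hb h.2.2.2.2.2.2.2.2.2.2)]
        · rw [if_neg hw, if_neg]
          rintro ⟨-, -, h3, -, -, -, h7, h8, h9, h10, -⟩
          exact hw ⟨h3, h7, h8, h9, h10⟩
      · intro t _ ht
        refine if_neg fun h => ht ?_
        obtain ⟨-, h2, -, -, -, h6, -⟩ := h
        omega
      · intro ht
        simp only [Finset.mem_range] at ht
        refine if_neg fun h => ht ?_
        obtain ⟨-, h2, -, -, -, h6, h7, h8, -, h10, -⟩ := h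
        omega
    rw [Finset.sum_congr rfl hrow]
    rw [sum_levWindow_reindex (fun c e => if brk (n - n') c then ε * x ^ (e + (n - n') / 2) else 0) hdn' hℓ₁ (by omega)]
    rw [Finset.mul_sum]
    refine Finset.sum_congr rfl fun c _ => ?_
    by_cases hb : brk (n - n') c
    · rw [if_pos hb, if_pos hb]; congr 1; ring
    · rw [if_neg hb, if_neg hb, mul_zero]
  · rw [if_neg hc]
    refine Finset.sum_eq_zero fun r _ => Finset.sum_eq_zero fun t _ => if_neg ?_
    rintro ⟨h1, h2, h3, h4, h5, h6, -⟩
    refine hc ⟨h5, by omega, ?_⟩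
    have : t - r = n - n' := by omega
    rw [← this]; exact Nat.mod_eq_zero_of_dvd h4

end Window

section Plane

variable {R : Type*} [CommRing R]

/-- **ONE PLANE OF THE TWO-TOKEN κ-TABLE** (slot fixed; `tube` = «this plane is the slot's own foot», `brk` = the glue bracket; levels `ℓ₁`, `ℓ₂`): the triangular sum
`Σ_{r<t≤B} φ r t` of a row function following ★ p860066's table — on-branch row `r = 0` with the apex read `s + ℓ₁ ≤ n`, tube rows with the reads
`2ρ + ℓ₁ ≤ n_r`, `2ρ + s + ℓ₁ ≤ n`, `2ρ + ℓ₂ ≤ 2n_r` (read leg `n_r`), the `D₁`-locus column, zero odd rows — is ★ `kappa_plane_sum`'s FOOT part at the shifted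
parameters `(n − ℓ₁, N)`, `N = min(min(n', n''), n_r − ℓ₁, 2n_r − ℓ₂)`, plus §2's LOCUS WINDOW. [folklore] -/
theorem kappa_plane_sum_lev (x ω ε : R) (tube : Prop) [Decidable tube] (brk : ℕ → ℕ → Prop) [DecidableRel brk] {d n n' n'' nr ℓ₁ ℓ₂ B : ℕ}
    (hd : 2 ≤ d) (hdn' : d + ℓ₁ ≤ n') (hdn'' : d ≤ n'') (hdnr : d + ℓ₁ ≤ nr) (hℓ₂ : ℓ₂ + d ≤ 2 * nr) (hB : n + n' + 1 ≤ B) (φ : ℕ → ℕ → R)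
    (hT : ∀ s, 1 ≤ s → φ 0 s = if tube ∧ 2 * d ≤ s ∧ 2 ∣ s ∧ s + ℓ₁ ≤ n then ω * x ^ (s / 2) else 0)
    (hG : ∀ ρ s, 1 ≤ ρ → 1 ≤ s → φ (2 * ρ) (2 * ρ + s) =
      (if tube ∧ 2 ∣ s ∧ 2 * ρ ≤ min n' n'' ∧ 2 * ρ + s ≤ n ∧ 2 * ρ + ℓ₁ ≤ nr ∧ 2 * ρ + s + ℓ₁ ≤ n ∧ 2 * ρ + ℓ₂ ≤ 2 * nr then
          ω * x ^ (2 * ρ + s / 2 - 1) * ((if 2 * d ≤ s then x - 1 else 0) - (if s + 2 = 2 * d then 1 else 0)) else 0) +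
      (if 2 ∣ s ∧ n' = n'' ∧ n = n' + s ∧ n' < 2 * ρ + ℓ₁ ∧ ℓ₁ + ρ ≤ n' ∧ ℓ₁ + 2 * ρ - n' ≤ n' - d + 1 ∧ 2 * ρ + ℓ₂ ≤ 2 * n'
        then (if brk s ((ℓ₁ + 2 * ρ - n' + 1) / 2) then ε else 0) * x ^ (2 * ρ + s / 2 - (ℓ₁ + 2 * ρ - n' + 1) / 2) else 0))
    (hZ : ∀ r s, 1 ≤ r → ¬ 2 ∣ r → 1 ≤ s → φ r (r + s) = 0) :
    ∑ r ∈ range (B + 1), ∑ t ∈ range (B + 1), (if r < t then φ r t else 0) =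
      (if tube then ω * (∑ j ∈ Icc d ((n - ℓ₁) / 2), x ^ j
          + ∑ ρ ∈ Icc 1 (min (min n' n'') (min (nr - ℓ₁) (2 * nr - ℓ₂)) / 2),
              ((if ρ + d ≤ (n - ℓ₁) / 2 then x ^ ((n - ℓ₁) / 2 + ρ) - x ^ (2 * ρ + d - 1) else 0)
                - (if ρ + d ≤ (n - ℓ₁) / 2 + 1 then x ^ (2 * ρ + d - 2) else 0)))
        else 0)
      + (if n' = n'' ∧ n' < n ∧ (n - n') % 2 = 0 then
          ε * ∑ c ∈ Icc 1 (min (n' - ℓ₁ - (n' - ℓ₁) / 2) (min ((2 * n' - ℓ₂) / 2 - (n' - ℓ₁) / 2) ((2 * n' - d + 1 - ℓ₁) / 2 - (n' - ℓ₁) / 2))),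
            (if brk (n - n') c then x ^ (2 * ((n' - ℓ₁) / 2) + (n - n') / 2 + c) else 0)
        else 0) := by
  -- the shifted parameters
  set N : ℕ := min (min n' n'') (min (nr - ℓ₁) (2 * nr - ℓ₂)) with hNdef
  have hNiff : ∀ r, r ≤ N ↔ r ≤ min n' n'' ∧ r + ℓ₁ ≤ nr ∧ r + ℓ₂ ≤ 2 * nr := fun r => by
    rw [hNdef]; simp only [le_min_iff]; omega
  have hNd : d ≤ N := (hNiff d).2 ⟨le_min (by omega) hdn'', by omega, by omega⟩
  have hNle : N ≤ n' := le_trans (min_le_left _ _) (min_le_left _ _)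
  set M : ℕ := N + (N + d) % 2 with hMdef
  have hMpar : M % 2 = d % 2 := by omega
  have hNM : min M N = N := min_eq_right (by omega)
  -- the on-branch ∕ tube part of the row function, in ★ `kappa_plane_sum`'s shape at `(n − ℓ₁, M, N)`, glue letter `0`
  obtain ⟨φT, hφT⟩ : ∃ f : ℕ → ℕ → R, ∀ r t, f r t =
      (if r = 0 then (if tube ∧ 2 * d ≤ t ∧ 2 ∣ t ∧ t ≤ n - ℓ₁ then ω * x ^ (t / 2) else 0) else 0) +
      (if 1 ≤ r ∧ 2 ∣ r then
        (if tube ∧ 2 ∣ (t - r) ∧ r ≤ min M N ∧ r + (t - r) ≤ n - ℓ₁ then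
          ω * x ^ (r + (t - r) / 2 - 1) * ((if 2 * d ≤ t - r then x - 1 else 0) - (if t - r + 2 = 2 * d then 1 else 0)) else 0)
        else 0) := ⟨_, fun _ _ => rfl⟩
  have hT' : ∀ s, 1 ≤ s → φT 0 s = if tube ∧ 2 * d ≤ s ∧ 2 ∣ s ∧ s ≤ n - ℓ₁ then ω * x ^ (s / 2) else 0 := by
    intro s hs
    rw [hφT, if_pos rfl, if_neg (show ¬ (1 ≤ 0 ∧ 2 ∣ 0) from fun h => absurd h.1 (by norm_num)), add_zero]
  have hG' : ∀ ρ s, 1 ≤ ρ → 1 ≤ s → φT (2 * ρ) (2 * ρ + s) =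
      (if tube ∧ 2 ∣ s ∧ 2 * ρ ≤ min M N ∧ 2 * ρ + s ≤ n - ℓ₁ then
          ω * x ^ (2 * ρ + s / 2 - 1) * ((if 2 * d ≤ s then x - 1 else 0) - (if s + 2 = 2 * d then 1 else 0)) else 0) +
      (if 2 ∣ s ∧ M = N ∧ n - ℓ₁ = M + s ∧ M < 2 * ρ ∧ 2 * ρ - M ≤ M - d + 1
        then (if brk s ((2 * ρ - M + 1) / 2) then (0 : R) else 0) * x ^ (2 * ρ + s / 2 - (2 * ρ - M + 1) / 2) else 0) := by
    intro ρ s hρ hs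
    rw [hφT, if_neg (show ¬ (2 * ρ = 0) by omega), zero_add, if_pos ⟨by omega, dvd_mul_right 2 ρ⟩, Nat.add_sub_cancel_left]
    have h0 : (if 2 ∣ s ∧ M = N ∧ n - ℓ₁ = M + s ∧ M < 2 * ρ ∧ 2 * ρ - M ≤ M - d + 1
        then (if brk s ((2 * ρ - M + 1) / 2) then (0 : R) else 0) * x ^ (2 * ρ + s / 2 - (2 * ρ - M + 1) / 2) else 0) = 0 := by
      rw [ite_self, zero_mul, ite_self]
    rw [h0, add_zero]
  have hZ' : ∀ r s, 1 ≤ r → ¬ 2 ∣ r → 1 ≤ s → φT r (r + s) = 0 := by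
    intro r s hr hr2 _
    rw [hφT, if_neg (show ¬ (r = 0) by omega), zero_add, if_neg (fun h => hr2 h.2)]
  have hplaneT := kappa_plane_sum x ω 0 tube brk hd (show d ≤ M by omega) (fun _ => hMpar) (show n - ℓ₁ + M ≤ B by omega) φT hT' hG' hZ'
  rw [hNM] at hplaneT
  -- the locus part of the row function
  obtain ⟨φL, hφL⟩ : ∃ f : ℕ → ℕ → R, ∀ r t, f r t =
      (if 1 ≤ r ∧ r < t ∧ 2 ∣ r ∧ 2 ∣ (t - r) ∧ n' = n'' ∧ n = n' + (t - r) ∧ n' < r + ℓ₁ ∧ ℓ₁ + r / 2 ≤ n' ∧ ℓ₁ + r - n' ≤ n' - d + 1 ∧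
          r + ℓ₂ ≤ 2 * n' ∧ brk (t - r) ((ℓ₁ + r - n' + 1) / 2)
        then ε * x ^ (r + (t - r) / 2 - (ℓ₁ + r - n' + 1) / 2) else 0) := ⟨_, fun _ _ => rfl⟩
  have hplaneL := sum_locusDouble_lev x ε brk (d := d) (n := n) (n' := n') (n'' := n'') (ℓ₁ := ℓ₁) (ℓ₂ := ℓ₂) (B := B) (by omega) (by omega) (by omega)
  -- the decomposition `φ = φT + φL` on the triangle
  have hsplit : ∀ r ∈ range (B + 1), ∀ t ∈ range (B + 1), (if r < t then φ r t else 0) = (if r < t then φT r t else 0) + φL r t := by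
    intro r _ t _
    by_cases hrt : r < t
    · rw [if_pos hrt, if_pos hrt]
      obtain ⟨s, rfl⟩ : ∃ s, t = r + s := ⟨t - r, by omega⟩
      have hs : 1 ≤ s := by omega
      rcases Nat.eq_zero_or_pos r with rfl | hr
      · -- on-branch row
        simp only [zero_add]
        have hL0 : φL 0 s = 0 := by
          rw [hφL, if_neg]
          rintro ⟨h, -⟩
          exact absurd h (by norm_num)
        rw [hT s hs, hT' s hs, hL0, add_zero]
        refine if_congr ?_ rfl rfl
        constructor
        · rintro ⟨h1, h2, h3, h4⟩; exact ⟨h1, h2, h3, by omega⟩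
        · rintro ⟨h1, h2, h3, h4⟩; exact ⟨h1, h2, h3, by omega⟩
      · by_cases hr2 : 2 ∣ r
        · -- tube ∕ locus row `r = 2ρ`
          obtain ⟨ρ, rfl⟩ := hr2
          have hρ : 1 ≤ ρ := by omega
          have h0 : (if 2 ∣ s ∧ M = N ∧ n - ℓ₁ = M + s ∧ M < 2 * ρ ∧ 2 * ρ - M ≤ M - d + 1
              then (if brk s ((2 * ρ - M + 1) / 2) then (0 : R) else 0) * x ^ (2 * ρ + s / 2 - (2 * ρ - M + 1) / 2) else 0) = 0 := by
            rw [ite_self, zero_mul, ite_self]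
          rw [hG ρ s hρ hs, hG' ρ s hρ hs, h0, add_zero, hφL]
          simp only [Nat.add_sub_cancel_left, Nat.mul_div_cancel_left ρ (by norm_num : 0 < 2)]
          congr 1
          · refine if_congr ?_ rfl rfl
            constructor
            · rintro ⟨h1, h2, h3, h4, h5, h6, h7⟩
              exact ⟨h1, h2, by rw [hNM]; exact (hNiff _).2 ⟨h3, h5, h7⟩, by omega⟩
            · rintro ⟨h1, h2, h3, h4⟩
              rw [hNM] at h3
              obtain ⟨h3a, h3b, h3c⟩ := (hNiff _).1 h3
              exact ⟨h1, h2, h3a, by omega, by omega, by omega, by omega⟩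
          · by_cases hc : 2 ∣ s ∧ n' = n'' ∧ n = n' + s ∧ n' < 2 * ρ + ℓ₁ ∧ ℓ₁ + ρ ≤ n' ∧ ℓ₁ + 2 * ρ - n' ≤ n' - d + 1 ∧ 2 * ρ + ℓ₂ ≤ 2 * n'
            · obtain ⟨c1, c2, c3, c4, c5, c6, c7⟩ := hc
              rw [if_pos ⟨c1, c2, c3, c4, c5, c6, c7⟩]
              by_cases hb : brk s ((ℓ₁ + 2 * ρ - n' + 1) / 2)
              · rw [if_pos hb, if_pos ⟨by omega, by omega, dvd_mul_right 2 ρ, c1, c2, c3, c4, c5, c6, c7, hb⟩]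
              · rw [if_neg hb, zero_mul, if_neg (fun h => hb h.2.2.2.2.2.2.2.2.2.2)]
            · rw [if_neg hc, if_neg]
              rintro ⟨-, -, -, h4, h5, h6, h7, h8, h9, h10, -⟩
              exact hc ⟨h4, h5, h6, h7, h8, h9, h10⟩
        · -- odd row
          rw [hZ r s hr hr2 hs, hZ' r s hr hr2 hs, hφL, if_neg (fun h => hr2 h.2.2.1), add_zero]
    · rw [if_neg hrt, if_neg hrt, hφL, if_neg (fun h => hrt h.2.1), add_zero]
  rw [Finset.sum_congr rfl fun r hr => Finset.sum_congr rfl fun t ht => hsplit r hr t ht]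
  simp only [Finset.sum_add_distrib]
  rw [hplaneT]
  simp only [zero_mul, ite_self, add_zero]
  congr 1
  simp only [hφL]
  exact hplaneL

end Plane

section Diag

variable {R : Type*} [CommRing R]

/-- **THE DIAGONAL (core-hanging `H`) SUM of the two-token table**: `Σ_r ψ r` with the hanging cells of ★ p860066's `hH` (`m < 2ρ + ℓ₁`, `X = ℓ₁ + 2ρ − m ≤ m − d + 1`,
`d ≤ ⌈X∕2⌉`, `ℓ₁ + ρ ≤ m`, `2ρ + ℓ₂ ≤ 2m`, value `εH·x^{2ρ − ⌈X∕2⌉}`) is the window `εH·Σ_{1 ≤ c ≤ C} [d ≤ c]·x^{2⌊(m−ℓ₁)∕2⌋ + c}` (present iff the key is equilateral);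
twin of ★ `kappa_diag_sum` (the case `ℓ₁ = ℓ₂ = 0`), parity-free. [folklore] -/
theorem kappa_diag_sum_lev (x εH : R) (e1 e2 : Prop) [Decidable e1] [Decidable e2] {d m ℓ₁ ℓ₂ B : ℕ} (hdm : d + ℓ₁ ≤ m) (hB : e1 → e2 → 2 * m ≤ B)
    (ψ : ℕ → R) (h0 : ψ 0 = 0)
    (hH : ∀ ρ, 1 ≤ ρ → ψ (2 * ρ) =
      if e1 ∧ e2 ∧ m < 2 * ρ + ℓ₁ ∧ ℓ₁ + 2 * ρ - m ≤ m - d + 1 ∧ d ≤ (ℓ₁ + 2 * ρ - m + 1) / 2 ∧ ℓ₁ + ρ ≤ m ∧ 2 * ρ + ℓ₂ ≤ 2 * m then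
        εH * x ^ (2 * ρ - (ℓ₁ + 2 * ρ - m + 1) / 2) else 0)
    (hZ : ∀ r, 1 ≤ r → ¬ 2 ∣ r → ψ r = 0) :
    ∑ r ∈ range (B + 1), ψ r =
      if e1 ∧ e2 then
        εH * ∑ c ∈ Icc 1 (min (m - ℓ₁ - (m - ℓ₁) / 2) (min ((2 * m - ℓ₂) / 2 - (m - ℓ₁) / 2) ((2 * m - d + 1 - ℓ₁) / 2 - (m - ℓ₁) / 2))),
          (if d ≤ c then x ^ (2 * ((m - ℓ₁) / 2) + c) else 0)
      else 0 := by
  by_cases he : e1 ∧ e2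
  · rw [if_pos he]
    have hpt : ∀ r, ψ r = if 2 ∣ r ∧ m < r + ℓ₁ ∧ ℓ₁ + r / 2 ≤ m ∧ ℓ₁ + r - m ≤ m - d + 1 ∧ r + ℓ₂ ≤ 2 * m then
        (if d ≤ (ℓ₁ + r - m + 1) / 2 then εH * x ^ (r - (ℓ₁ + r - m + 1) / 2) else 0) else 0 := by
      intro r
      rcases Nat.eq_zero_or_pos r with rfl | hr
      · rw [h0, if_neg (fun h => by omega)]
      · by_cases hr2 : 2 ∣ r
        · obtain ⟨ρ, rfl⟩ : ∃ ρ, r = 2 * ρ := ⟨r / 2, by omega⟩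
          rw [hH ρ (by omega), Nat.mul_div_cancel_left ρ (by norm_num : 0 < 2)]
          simp only [he.1, he.2, true_and]
          split_ifs <;> first | rfl | (exfalso; omega)
        · rw [hZ r hr hr2, if_neg (fun h => hr2 h.1)]
    simp only [hpt]
    rw [sum_levWindow_reindex (fun c e => if d ≤ c then εH * x ^ e else 0) (by omega) (by omega) (hB he.1 he.2), Finset.mul_sum]
    refine Finset.sum_congr rfl fun c _ => ?_
    by_cases hb : d ≤ c
    · rw [if_pos hb, if_pos hb]
    · rw [if_neg hb, if_neg hb, mul_zero]
  · rw [if_neg he]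
    refine Finset.sum_eq_zero fun r _ => ?_
    rcases Nat.eq_zero_or_pos r with rfl | hr
    · exact h0
    · by_cases hr2 : 2 ∣ r
      · obtain ⟨ρ, rfl⟩ : ∃ ρ, r = 2 * ρ := ⟨r / 2, by omega⟩
        rw [hH ρ (by omega), if_neg (fun h => he ⟨h.1, h.2.1⟩)]
      · exact hZ r hr hr2

end Diag

end Summit.HodgeConjecture.HodgeConjecture.Cruxes.H413.F0P3cDyRamLevBoxSumPlanes
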